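import Summits.BirchSwinnertonDyer.BirchSwinnertonDyer.Theorems.SchneiderFreeAdditiveX3TwoWingsSplit
import Summits.BirchSwinnertonDyer.BirchSwinnertonDyer.Theorems.SchneiderFreeAdditiveX3UpperCoSocketOfKY
import Summits.BirchSwinnertonDyer.BirchSwinnertonDyer.Theorems.SchneiderFreeAdditiveX3UpperKYReadHyps
import HarnessLib

/-!
# Route `SchneiderFreeAdditiveX3` (K1 door), SECOND WING on the (G-ord, `e = 2`) cell BY NAME from the
# KY-read inputs — `PrintedFacts → ControlFacts → RebasedFactsG → thm351_OPEN → KYReadCHUnit → KYReadSliverUpper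
# → ‹co-socket›`, `… → TwistUnitFieldAt → MissingUpperBoundAt`, and the door + wing residue with `hCoG` discharged

Cell `bsd-schneider-ideate`, seat `bsd-schneider-door-c5` (prover, generation 9). The H-record-shaped closers of
the wing on the (G-ord, `e = 2`) cell in the route file's vocabulary (twin of door-c3 gen 8's
`gordTwoBranchIMC_of_KYRead` / `additiveX3RankOneLower_of_KYRead` for the LOWER record):

* `coIMC_gordTwo_of_KYRead` — the wing's co-socket `hCoG` (candidate crux `GordTwoBranchCoIMC` of the sibling
  route, memo `ROUTE-P2-upper-v2-g13.md` U25) ⇐ `PrintedFacts` ∧ `ControlFacts` ∧ (Gross 2004 ∧ CM-rationality ∧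
  CST Thm 1.1) ∧ `thm351_OPEN` (PRE; `⊆ Char` half, `μ`-free) ∧ `KYReadCHUnit` ∧ `KYReadSliverUpper` —
  `Upper.additiveIMCUpperBDPInputManinAt_of_facts_of_KY_OPEN_of_CHUnit` (p491532) with the facts destructured.
* `missingUpperBoundAt_gordTwo_of_KYRead_of_twistUnitField` — the UPPER half `ord_p #Ш(E) ≤ ord_p #Ш(E)_an` on the
  whole (G-ord, `e = 2`) cell in analytic rank one ⇐ the same + the SPLIT twist-unit datum on the cell
  (`hTU`, candidate crux `TwistUnitX3Split`): the sibling route's `closes` restricted to this cell, by name, via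
  `Upper.missingUpperBoundAt_gordTwo_of_coIMC_of_control_of_twistUnitField` (p489359) and the CLOSED control item
  19548 (`anticycControlAdditiveKF_proof`).
* `missingPPartAt_sstTwist_of_KYRead_of_coIMCM_of_twistUnitField` — the FULL rank-one residue (`MissingPPartAt`,
  both halves of BSD_p) on B6 ∩ X3 ∩ sst-twist with the (G-ord) co-socket DISCHARGED to the KY-read inputs: what
  is left as free binders is exactly {`PotMultBranchIMC` (r2, NONE), `hCoM` (its Kolyvagin-direction twin on
  (M), NONE), `hTU`} plus the PRE/untyped named inputs {`thm351_OPEN`, `KYReadCH`, `KYReadCHUnit`,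
  `KYReadSliverUpper`} and the fact bundles.

HONEST FRAMING: CONDITIONAL on every displayed hypothesis (two have NO print, one is a preprint claim, three are
untyped/strengthened readings of print, `hTU` is a per-pair certificate / open class-wide); closes no item; no
rung leaf is registered for the wing; BSD is NOT advanced beyond this typed reduction.

References: [KellerYin2024b] arXiv:2410.23241 Thm. 3.5.1; [CastellaHsieh2018] Thm. 5.7, Lemma 5.4;
[JetchevSkinnerWan2017] §7.4.1; [Miller2011LMS] Def. 1.1; [GrossZagier1986] I.(6.3), (7.3); [KrizLi2019] Thm. 1.20.
-/

noncomputable section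

open scoped Classical

open Field NumberField IsDedekindDomain WeierstrassCurve
open Literature.NumberTheory.EllipticCurves Literature.NumberTheory.EllipticCurves.GreenbergSelmer
open Literature.NumberTheory.GaloisRepresentations
open Literature.NumberTheory.GaloisCohomology
open Literature.NumberTheory.EllipticCurves.ModularForms
  Literature.NumberTheory.EllipticCurves.CaiShuTian2014
  Literature.NumberTheory.EllipticCurves.KellerYin2024
  Literature.NumberTheory.EllipticCurves.Rank1Residual
  Literature.NumberTheory.EllipticCurves.Rank1Residual.Typed
  Summit.BirchSwinnertonDyer.Rank1Residual
  Summit.BirchSwinnertonDyer.Rank1Residual.X11b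
  Summit.BirchSwinnertonDyer.BirchSwinnertonDyer.Theorems.SchneiderFree
  Summit.BirchSwinnertonDyer.BirchSwinnertonDyer.Theorems.SchneiderFree.KYRead
  Summit.BirchSwinnertonDyer.BirchSwinnertonDyer.Theses.SchneiderFreeAdditiveX3

set_option linter.dupNamespace false
set_option autoImplicit false

namespace Summit.BirchSwinnertonDyer.BirchSwinnertonDyer.Theorems.SchneiderFree.Upper

/-- **The (G-ord, `e = 2`) co-socket record in the route file's vocabulary** — the wing's `hCoG` (co-T-B6-1♯
`Upper.AdditiveIMCUpperBDPInputManinAt` at every KY-normalised curve of the cell) ⇐ `PrintedFacts` (conjuncts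
Gross–Zagier, Kolyvagin, modularity ×2) ∧ `ControlFacts` (conjunct (i), Poitou–Tate Selmer-structure duality)
∧ the rebased road's three cite-only facts ∧ `thm351_OPEN` (Keller–Yin Thm. 3.5.1, PREPRINT, `⊆ Char` half
only) ∧ `KYReadCHUnit` ∧ `KYReadSliverUpper`. CONDITIONAL on the displayed hypotheses; nothing asserted about
BSD. [cite: KellerYin2024b, Thm. 3.5.1 (arXiv:2410.23241 p. 20) (preprint; hypothesis)]
[cite: CastellaHsieh2018, Thm. 5.7 and Lemma 5.4 (arXiv:1505.08165 pp. 17–19) (shape of KYReadCHUnit)] -/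
theorem coIMC_gordTwo_of_KYRead (hF : PrintedFacts) (hCF : ControlFacts)
    (hR : Gross2004.rankinLSeries_eq_mul_quadraticTwist ∧ phi_heegnerPointOfConductor_mem_ringClassField ∧
      thm11_ringClassChar)
    (hKY : thm351_imc_isTorsion_mu_zero_charIdeal_eq_OPEN) (hCHu : KYReadCHUnit)
    (hSlU : KYReadSliverUpper) :
    ∀ (W : WeierstrassCurve ℚ) [W.IsElliptic] [W.IsGloballyMinimal] (p : ℕ) [Fact p.Prime],
      p ≠ 2 → ClassX3 W p → Additive.SubGordTwo W p →
      (∃ Φ : AddSubgroup (geomTorsion W (p : ℤ)), IsRationalLine W p Φ ∧ ¬ LineDecompositionTrivialAt W p Φ) →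
      AdditiveIMCUpperBDPInputManinAt W p := by
  obtain ⟨hGZ, hKo, -, hmod, hPar, -⟩ := hF
  exact additiveIMCUpperBDPInputManinAt_of_facts_of_KY_OPEN_of_CHUnit hCF.1 hKo hGZ hR.1 hmod hPar hR.2.1 hR.2.2
    hKY hCHu hSlU

/-- **The second wing on the (G-ord, `e = 2`) cell BY NAME from the KY-read inputs and the SPLIT twist-unit
datum** — `MissingUpperBoundAt W p` (`ord_p #Ш(E) ≤ ord_p #Ш(E)_an`) for every globally minimal `W` with
`r_an = 1`, `p` odd, `ClassX3 W p`, `SubGordTwo W p` ⇐ `PrintedFacts` ∧ `ControlFacts` ∧ (Gross 2004 ∧ CM-rationality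
∧ CST Thm 1.1) ∧ `thm351_OPEN` ∧ `KYReadCHUnit` ∧ `KYReadSliverUpper` ∧ `hTU` (the split twist-unit datum on the cell).
The control EQUALITY is the CLOSED item 19548 (`anticycControlAdditiveKF_proof` fed `ControlFacts` + Kolyvagin);
the glue is `Upper.missingUpperBoundAt_gordTwo_of_coIMC_of_control_of_twistUnitField`. CONDITIONAL on the
displayed hypotheses; closes no item; BSD NOT advanced. [cite: JetchevSkinnerWan2017, §7.4.1 (arXiv:1512.06894 p. 30)]
[cite: Miller2011LMS, Def. 1.1] [cite: KellerYin2024b, Thm. 3.5.1 (preprint; hypothesis)] [cite: KrizLi2019, Thm. 1.20 (shape of hTU)] -/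
theorem missingUpperBoundAt_gordTwo_of_KYRead_of_twistUnitField (hF : PrintedFacts) (hCF : ControlFacts)
    (hR : Gross2004.rankinLSeries_eq_mul_quadraticTwist ∧ phi_heegnerPointOfConductor_mem_ringClassField ∧
      thm11_ringClassChar)
    (hKY : thm351_imc_isTorsion_mu_zero_charIdeal_eq_OPEN) (hCHu : KYReadCHUnit)
    (hSlU : KYReadSliverUpper)
    (hTU : ∀ (W : WeierstrassCurve ℚ) [W.IsElliptic] [W.IsGloballyMinimal] (p : ℕ) [Fact p.Prime],
      W.analyticRank = 1 → p ≠ 2 → ClassX3 W p → Additive.SubGordTwo W p → TwistUnitFieldAt W p) :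
    ∀ (W : WeierstrassCurve ℚ) [W.IsElliptic] [W.IsGloballyMinimal] (p : ℕ) [Fact p.Prime],
      W.analyticRank = 1 → p ≠ 2 → ClassX3 W p → Additive.SubGordTwo W p → MissingUpperBoundAt W p := by
  have hCo := coIMC_gordTwo_of_KYRead hF hCF hR hKY hCHu hSlU
  obtain ⟨hGZ, hKo, hGZK, hmod, hPar, hCas, hGZ73, -, -, hHP, -, -, -⟩ := hF
  have hCtl := SchneiderFreeAdditiveX3.anticycControlAdditiveKF_proof hCF.1 hCF.2.1 hCF.2.2.1 hCF.2.2.2 hKo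
  exact missingUpperBoundAt_gordTwo_of_coIMC_of_control_of_twistUnitField hGZ hKo hGZK hmod hPar hGZ73 hCas hHP
    hCtl hCo hTU

/-- **FULL BSD_p residue on B6 ∩ X3 ∩ sst-twist (r = 1) with the (G-ord) co-socket DISCHARGED to KY-read inputs.**
`MissingPPartAt W p` on the whole cell ⇐ DOOR {`PrintedFacts`, `ControlFacts`, `PotMultBranchIMC` (r2, NONE), the
rebased facts, `thm351_OPEN` (PRE), `KYReadCH`} + WING {`KYReadCHUnit`, `KYReadSliverUpper` (the (G-ord) co-socket's
KY-read inputs), `hCoM` (the (M) co-socket, NONE in print — the only wing binder still in socket shape), `hTU`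
(split twist-unit datum on the cell)}. = `missingPPartAt_sstTwist_of_door_of_wingSplit` with `hCoG` supplied by
`coIMC_gordTwo_of_KYRead`. CONDITIONAL on every displayed hypothesis; closes no item; BSD NOT advanced.
[cite: JetchevSkinnerWan2017, §7.4.1] [cite: KellerYin2024b, Thm. 3.5.1 (preprint; hypothesis)]
[cite: CastellaHsieh2018, Thm. 5.7 and Lemma 5.4 (shapes of KYReadCH / KYReadCHUnit)] [cite: Miller2011LMS, Def. 1.1] -/
theorem missingPPartAt_sstTwist_of_KYRead_of_coIMCM_of_twistUnitField (hF : PrintedFacts) (hCF : ControlFacts)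
    (h2 : PotMultBranchIMC)
    (hR : Gross2004.rankinLSeries_eq_mul_quadraticTwist ∧ phi_heegnerPointOfConductor_mem_ringClassField ∧
      thm11_ringClassChar)
    (hKY : thm351_imc_isTorsion_mu_zero_charIdeal_eq_OPEN) (hCH : KYReadCH) (hCHu : KYReadCHUnit)
    (hSlU : KYReadSliverUpper)
    (hCoM : ∀ (W : WeierstrassCurve ℚ) [W.IsElliptic] [W.IsGloballyMinimal] (p : ℕ) [Fact p.Prime],
      p ≠ 2 → ClassX3 W p → Additive.SubM W p →
      (∃ Φ : AddSubgroup (geomTorsion W (p : ℤ)), IsRationalLine W p Φ ∧ ¬ LineDecompositionTrivialAt W p Φ) →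
      AdditiveIMCUpperBDPInputManinAt W p)
    (hTU : ∀ (W : WeierstrassCurve ℚ) [W.IsElliptic] [W.IsGloballyMinimal] (p : ℕ) [Fact p.Prime],
      W.analyticRank = 1 → p ≠ 2 → ClassX3 W p → Additive.SubSemistableTwist W p → TwistUnitFieldAt W p) :
    ∀ (W : WeierstrassCurve ℚ) [W.IsElliptic] [W.IsGloballyMinimal] (p : ℕ) [Fact p.Prime],
      W.analyticRank = 1 → p ≠ 2 → ClassX3 W p → Additive.SubSemistableTwist W p → MissingPPartAt W p :=
  SchneiderFreeAdditiveX3.missingPPartAt_sstTwist_of_door_of_wingSplit hF hCF h2 hR hKY hCH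
    (coIMC_gordTwo_of_KYRead hF hCF hR hKY hCHu hSlU) hCoM hTU

end Summit.BirchSwinnertonDyer.BirchSwinnertonDyer.Theorems.SchneiderFree.Upper

end
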